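/-
Copyright (c) 2026 the pub-hodgecm-mathlib formalisation cell (harness21).  Prover seat hodgecm-mathlib-F0P3a-p07 (g13), 2026-09-01.  Road «S3-ram» seeding wave (LEAD T11-41∕T11-60; owner F0P3a-p06 (g15));
ROAD «P-1-ram» (architect A-p16 (g31)) organ A′ (iii) «κ-SUM = X̃ ALGEBRA» (deal 2026-09-01T23:11:46Z).
-/
import Mathlib.Algebra.BigOperators.Ring.Finset
import Mathlib.Algebra.BigOperators.Fin
import Mathlib.Data.Complex.Basic
import HarnessLib

/-!
# The A′ ASSEMBLY ARITHMETIC of the tame-ramified depth-zero κ-transfer (type (1)): conversion ∘ κ-signed counts ∘ Δ-law ∘ four-classes ⇒ `Σᶠ Δ‴Φ = ν_G(K)·c₀·Σ_j c_j X̃_j`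

Topic `NumberTheory/Rogawski1990`; namespace `Literature.NumberTheory.Rogawski1990.DepthZeroKappaSum`.  THEOREMS ONLY (pure finite-sum algebra over a field; no definition, no instance,
no notation, no named fact, no `sorry`).  Cell `pub/hodgecm-mathlib`, crux H413 = `stmt-HodgeConjecture-24833`; road «S3-ram» (LEAD F0P3a-plan (g12) T11-41; owner F0P3a-p06 (g15));
ROAD «P-1-ram» v2 (architect A-p16 (g31)) §2 organ **A′ (iii)** — the step that turns the four organs of STUB A′ `stub_typeOne_GSideProfile_ram` into its closed form.  Seat
F0P3a-p07 (g13).  HONEST LABEL: HC_CM is proved only modulo the cell's 2 remaining named inputs (hLiu418 24832, h413 24833) until rung 0 closes; «S3-ram» is Literature seeding with no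
books consequence; this file is unconditional, Mathlib-only, and discharges nothing by itself.

THE MATHEMATICS ([Rogawski1990] §4.9 Prop. 4.9.1 (a) pp. 54–56, §12.2; [LanglandsShelstad1987] §1.3–§1.4; [Flicker1998UnitaryFL] §2).  At a `G`-regular type-(1) `γ_H` near `1` the
κ-weighted sum `S = Σᶠ_c Δ‴(γ_H, c)·Φ(c, g)` over the `G`-classes in the stable class runs over FOUR classes `t_b` (`b ∈ ι`, `|ι| = 4`; ★ p847076 four-classes expansion
**(iv)** `S = Σ_b Δ(γ_H, t_b)·Φ(⟦t_b⟧, g)`); on a depth-zero piece `g` constant on the residual strata `j ∈ J` with values `c_j` the orbital integrals are strata counts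
**(i)** `Φ(⟦t_b⟧, g) = ν_G(K)·Σ_j c_j·n_{b,j}` (conversion organ, F0P3a-p05 (g16)); the fixed-lattice counts obey the κ-SIGNED COUNT LAW **(ii)** `Σ_b κ_b·n_{b,j} = ε·Q·X̃_j`
(`ε = ε(γ_H) ∈ {±1}`, `Q = q^{(N₁+N₂)∕2}`; organ (a2), F0P3a-p01 (g16) ∕ F0P2-p01 (g15); CERT P1ram fa4d2046) and the transfer factor is **(iii)** `Δ(γ_H, t_b) = C·κ_b`,
`C·ε·Q = c₀` (organ (iv), F0P3b-p01 (g13): `C = c₀·ε·Q⁻¹`).  THEN, exchanging the two finite sums and using `ε² = 1`: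
**`S = ν_G(K)·c₀·Σ_j c_j·X̃_j`** — the closed form of STUB A′ (A-p16 skeleton v4 :84, `X N = c₀·Σ_j c_j(g)·X̃_j(N)`).  Stated over an arbitrary field `F` with arbitrary finite
index types `ι` (literals) and `J` (strata), so the skeleton instantiates it by `exact` after `obtain`-ing (i)–(iv) in its own tokens.
* `sum_mul_eq_mul_sum_of_conversion_of_signedCount` — (i)+(ii)+(iii) with the product law `C·(ε·Q) = c₀`: `Σ_b Δ_b·Φ_b = ν·c₀·Σ_j c_j·X̃_j`.
* `eq_mul_sum_of_fourClasses_of_conversion_of_signedCount` — the same read through (iv) on an abstract left-hand side `S`.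
* `eq_mul_sum_of_fourClasses_of_conversion_of_signedCount_of_sq_eq_one` — with `C := c₀·ε·Q⁻¹`, `ε² = 1`, `Q ≠ 0` (A-p16's literal (iii)).
* `eq_mul_sum_of_fourClasses₂_of_conversion_of_signedCount` — ★ p847076's curried shape: literals `b₀ b₁ : Fin 2`, `Σᶠ Δ‴Φ = C·Σ_{b₀}Σ_{b₁} κ_{b₀b₁}Φ_{b₀b₁}`.

## References
* [Rogawski1990] J. D. Rogawski, *Automorphic Representations of Unitary Groups in Three Variables*, Ann. of Math. Stud. 123 (1990), §4.9 Prop. 4.9.1 pp. 54–56; §12.2 p. 173.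
* [LanglandsShelstad1987] R. P. Langlands, D. Shelstad, *On the definition of transfer factors*, Math. Ann. 278 (1987), §1.3–§1.4.
* [Flicker1998UnitaryFL] Y. Z. Flicker, *Elementary proof of the fundamental lemma for a unitary group*, Canad. J. Math. 50 (1998), §2.
-/

set_option autoImplicit false

open Finset
open scoped BigOperators

namespace Literature.NumberTheory.Rogawski1990.DepthZeroKappaSum

variable {F : Type*} [Field F] {ι J : Type*} [Fintype ι] [Fintype J]

/-- **κ-SUM ALGEBRA (i)+(ii)+(iii)**: if `Φ_b = ν·Σ_j c_j·n_{b,j}` (conversion), `Σ_b κ_b·n_{b,j} = ε·Q·X̃_j` (κ-signed count law) and `Δ_b = C·κ_b` with `C·(ε·Q) = c₀` (Δ-law), then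
`Σ_b Δ_b·Φ_b = ν·c₀·Σ_j c_j·X̃_j` — exchange the two finite sums. [cite: Rogawski1990, §4.9 Prop. 4.9.1 (a) pp. 54–56] [cite: LanglandsShelstad1987, §1.3–§1.4] -/
theorem sum_mul_eq_mul_sum_of_conversion_of_signedCount
    (ν c₀ ε Q C : F) (Φ Δ κ : ι → F) (n : ι → J → F) (c X : J → F)
    (hconv : ∀ b, Φ b = ν * ∑ j, c j * n b j)
    (hcount : ∀ j, ∑ b, κ b * n b j = ε * Q * X j)
    (hΔ : ∀ b, Δ b = C * κ b) (hC : C * (ε * Q) = c₀) :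
    ∑ b, Δ b * Φ b = ν * c₀ * ∑ j, c j * X j := by
  -- expand each summand into a sum over the strata, then exchange the sums
  have hterm : ∀ b, Δ b * Φ b = ∑ j, (C * ν) * (c j * (κ b * n b j)) := fun b => by
    rw [hΔ, hconv, Finset.mul_sum, Finset.mul_sum]
    exact Finset.sum_congr rfl fun j _ => by ring
  rw [Finset.sum_congr rfl (fun b _ => hterm b), Finset.sum_comm]
  -- inner sum: the κ-signed count law
  have hinner : ∀ j, ∑ b, (C * ν) * (c j * (κ b * n b j)) = (C * ν) * (c j * (ε * Q * X j)) := fun j => by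
    rw [← Finset.mul_sum, ← Finset.mul_sum, hcount]
  rw [Finset.sum_congr rfl (fun j _ => hinner j), ← Finset.mul_sum]
  -- `C·ν·Σ_j c_j·(εQ X̃_j) = ν·(C·ε·Q)·Σ_j c_j X̃_j = ν·c₀·Σ_j c_j X̃_j`
  have hre : ∑ j, c j * (ε * Q * X j) = (ε * Q) * ∑ j, c j * X j := by
    rw [Finset.mul_sum]
    exact Finset.sum_congr rfl fun j _ => by ring
  rw [hre, ← hC]
  ring

/-- **THE A′ ASSEMBLY** (four classes (iv) + conversion (i) + κ-signed counts (ii) + Δ-law (iii)): an abstract left-hand side `S` (the tree's `Σᶠ_c Δ‴(γ_H, c)·Φ(c, g)`) equal to the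
four-classes sum `Σ_b Δ_b·Φ_b` is `ν·c₀·Σ_j c_j·X̃_j`. [cite: Rogawski1990, §4.9 Prop. 4.9.1 (a) pp. 54–56] [cite: Flicker1998UnitaryFL, §2] -/
theorem eq_mul_sum_of_fourClasses_of_conversion_of_signedCount
    (S ν c₀ ε Q C : F) (Φ Δ κ : ι → F) (n : ι → J → F) (c X : J → F)
    (hS : S = ∑ b, Δ b * Φ b)
    (hconv : ∀ b, Φ b = ν * ∑ j, c j * n b j)
    (hcount : ∀ j, ∑ b, κ b * n b j = ε * Q * X j)
    (hΔ : ∀ b, Δ b = C * κ b) (hC : C * (ε * Q) = c₀) :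
    S = ν * c₀ * ∑ j, c j * X j := by
  rw [hS]
  exact sum_mul_eq_mul_sum_of_conversion_of_signedCount ν c₀ ε Q C Φ Δ κ n c X hconv hcount hΔ hC

/-- **THE A′ ASSEMBLY with A-p16's literal Δ-law `C = c₀·ε·Q⁻¹`** (`ε² = 1` is the only property of the sign used; `Q = q^{(N₁+N₂)∕2} ≠ 0`):
`S = ν·c₀·Σ_j c_j·X̃_j`. [cite: Rogawski1990, §4.9 Prop. 4.9.1 (a) pp. 54–56; §12.2 p. 173] [cite: LanglandsShelstad1987, §1.3–§1.4] -/
theorem eq_mul_sum_of_fourClasses_of_conversion_of_signedCount_of_sq_eq_one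
    (S ν c₀ ε Q : F) (Φ Δ κ : ι → F) (n : ι → J → F) (c X : J → F)
    (hε : ε ^ 2 = 1) (hQ : Q ≠ 0)
    (hS : S = ∑ b, Δ b * Φ b)
    (hconv : ∀ b, Φ b = ν * ∑ j, c j * n b j)
    (hcount : ∀ j, ∑ b, κ b * n b j = ε * Q * X j)
    (hΔ : ∀ b, Δ b = c₀ * ε * Q⁻¹ * κ b) :
    S = ν * c₀ * ∑ j, c j * X j := by
  refine eq_mul_sum_of_fourClasses_of_conversion_of_signedCount S ν c₀ ε Q (c₀ * ε * Q⁻¹) Φ Δ κ n c X hS hconv hcount hΔ ?_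
  have hε' : ε * ε = 1 := by rw [← sq]; exact hε
  calc c₀ * ε * Q⁻¹ * (ε * Q) = c₀ * (ε * ε) * (Q⁻¹ * Q) := by ring
    _ = c₀ := by rw [hε', inv_mul_cancel₀ hQ, mul_one, mul_one]

/-- **THE A′ ASSEMBLY IN ★ p847076's CURRIED SHAPE** (`UnitFundamentalLemmaNonsplitFourClassesAssembly`: the four literals are indexed by `b₀ b₁ : Fin 2` as a DOUBLE sum and the
transfer factor is already factored, `Σᶠ_c Δ‴Φ = C·Σ_{b₀} Σ_{b₁} κ_{b₀b₁}·Φ_{b₀b₁}`, `C = finTau·finWeylRatio`): with the conversion law per literal, the κ-signed count law as a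
double sum, and `C·(ε·Q) = c₀`:  `S = ν·c₀·Σ_j c_j·X̃_j`. [cite: Rogawski1990, §4.9 Prop. 4.9.1 (a) pp. 54–56] [cite: Flicker1998UnitaryFL, §2] -/
theorem eq_mul_sum_of_fourClasses₂_of_conversion_of_signedCount {β₀ β₁ : Type*} [Fintype β₀] [Fintype β₁]
    (S ν c₀ ε Q C : F) (Φ κ : β₀ → β₁ → F) (n : β₀ → β₁ → J → F) (c X : J → F)
    (hS : S = C * ∑ b₀, ∑ b₁, κ b₀ b₁ * Φ b₀ b₁)
    (hconv : ∀ b₀ b₁, Φ b₀ b₁ = ν * ∑ j, c j * n b₀ b₁ j)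
    (hcount : ∀ j, ∑ b₀, ∑ b₁, κ b₀ b₁ * n b₀ b₁ j = ε * Q * X j)
    (hC : C * (ε * Q) = c₀) :
    S = ν * c₀ * ∑ j, c j * X j := by
  -- uncurry the literal index to `β₀ × β₁` and read `Δ_p := C·κ_p`
  refine eq_mul_sum_of_fourClasses_of_conversion_of_signedCount (ι := β₀ × β₁) S ν c₀ ε Q C (fun p => Φ p.1 p.2) (fun p => C * κ p.1 p.2) (fun p => κ p.1 p.2)
    (fun p => n p.1 p.2) c X ?_ (fun p => hconv p.1 p.2) (fun j => ?_) (fun _ => rfl) hC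
  · rw [hS, Fintype.sum_prod_type, Finset.mul_sum]
    exact Finset.sum_congr rfl fun b₀ _ => by rw [Finset.mul_sum]; exact Finset.sum_congr rfl fun b₁ _ => by ring
  · rw [Fintype.sum_prod_type]
    exact hcount j

end Literature.NumberTheory.Rogawski1990.DepthZeroKappaSum
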